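import Summits.CriticalPhenomena.PercolationContinuityZ3.Theorems.PercNearOneGluingNoHeavyLowerTailDualBHKMaster
import HarnessLib

/-!
# Dual BHK inequality — the DELETED-TERMINAL rows `TW1({b})` and `TW2°` are corollaries of `BT₀`

Helper file (prover prim-gen-kcluster gen 40; `--supports stmt-CriticalPhenomena-4575`).  No definitions, no named facts, no
sorries.  Vocabulary of `…DualBHKDefs` (universe `U`, random edges `D` with weights `p ∈ [0,1]`, forced edges `F`, support
`E ⊇ D ∪ F`, root `a`; `evT`, `evXi`, `sepEv`, `Kset`).

The INEQ-CLAIMS table (prim-gen-kcluster gen 35 block, row "TW1/TW2", 2026-08-21) records as census-clean CONJECTURES the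
"cluster-termwise" strengthenings of the refined row R1 (`t·s_a ≤ u_b·u_c`, = `DualBHK.dualBHK`) in which the separating
factor and one connection factor are computed in the graph with a terminal DELETED:
* `TW1(L)`:  `P_G(a~b~c) · P_{G−L}(C_a meets every N(L)–c path) ≤ P_G(a~b) · P_{G−L}(a~c)`  (`L ∋ b` connected),
* `TW2(L,L′)`: `P_G(a~b~c) · P_{G−L−L′}(C_a separates N(L) from N(L′)) ≤ P_{G−L′}(a~b) · P_{G−L}(a~c)`,
and the gen-37/38 hand-off lists `TW2° := TW2({b},{c})` as still open (kit hunt j132159, 0 violations).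

THIS FILE: for SINGLETONS `L = {b}`, `L′ = {c}` both rows are theorems — immediate corollaries of prim-ineq-gen-2's kernel
theorem `BT₀` (`DualBHK.bt0`: `t(M,X) · P(C_a separates M from X) ≤ h(M) · h(X)` for vertex SETS `M, X`).
Proof (one-sided peeling, `diag_step`): condition the two factors that see the star of the deleted terminal `v` on its set
`K` of open neighbours; the other two factors do not see that star.  For `TW1({b})` this turns `P_G(abc)` into
`t_{U∖b}(K,{c})` and `P_G(ab)` into `h_{U∖b}(K)`, and since `C_a` separating ALL support neighbours of `b` from `c` implies
separating `K` from `c` (`sepEv_anti`), each `K`-term is an instance of `BT₀` on `U ∖ b`; summing over `K` with the star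
weights gives the row.  `TW2°` = the same twice (peel `c`, then `b`; `b, c` non-adjacent in the support), ending in
`BT₀(K, K′)` on `U ∖ {b,c}`.  The general rows (`|L| ≥ 2`: several glued attachment sets on one side, while the right-hand
connection factor is unglued) are NOT covered and stay conjectures.

* `diag_step` — generic one-sided peeling: if `E₁ ↔ G₁(K)`, `E₃ ↔ G₃(K)` pointwise (`K` = open neighbours of `v`), the
  `Gᵢ(K)` ignore the edges at `v`, and `PrW(G₁ K)·c₂ ≤ PrW(G₃ K)·c₄` for every `K` inside the support neighbourhood of `v`,
  then `PrW E₁ · c₂ ≤ PrW E₃ · c₄`.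
* `Kset_erase_of_not_mem` — the open neighbourhood of `v` does not change when a non-neighbour is removed from the universe.
* `tw1_erase` — **TW1({b})**: `t · P_{U∖b}(Sep(N(b), c)) ≤ P(a~b) · P_{U∖b}(a~c)`.
* `tw2_erase` — **TW2°**: `t · P_{U∖{b,c}}(Sep(N(b), N(c))) ≤ P_{U∖c}(a~b) · P_{U∖b}(a~c)` (`bc ∉ E`).
[this work; pattern: VandenbergHaggstromKahn2005 §1 (conditioning on the open star of a vertex)]
-/

namespace Summit.CriticalPhenomena.PercolationContinuityZ3.Theorems

namespace DualBHK

open SimpleGraph Finset Literature.Probability.Percolation.DecisionTree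

variable {V : Type*} [DecidableEq V]

/-! ### One-sided peeling -/

section Diag

/-- **One-sided peeling step.**  `D` random edges with weights `p ∈ [0,1]`, `F` forced edges, `E ⊇ D ∪ F` the support, `v`
the peeled vertex of the universe `U`.  If the events `E₁, E₃` translate pointwise (`S ⊆ D`) into events `G₁(K), G₃(K)`
of the open neighbourhood `K = Kset U (S ∪ F) v` which ignore the edges at `v`, and `PrW(G₁ K) · c₂ ≤ PrW(G₃ K) · c₄` for
every `K` inside the support neighbourhood `Kset U E v`, then `PrW E₁ · c₂ ≤ PrW E₃ · c₄` (decompose both masses over the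
configuration of the star of `v` and compare termwise). [this work] -/
theorem diag_step {D F E : Finset (Sym2 V)} {p : Sym2 V → ℝ} (hp0 : ∀ e, 0 ≤ p e) (hp1 : ∀ e, p e ≤ 1)
    (hDE : D ⊆ E) (hFE : F ⊆ E) (U : Finset V) (v : V)
    (E₁ E₃ : Set (Finset (Sym2 V))) (c₂ c₄ : ℝ) (G₁ G₃ : Set V → Set (Finset (Sym2 V)))
    (htr₁ : ∀ S, S ⊆ D → (S ∈ E₁ ↔ S ∈ G₁ (Kset U (S ∪ F) v)))
    (htr₃ : ∀ S, S ⊆ D → (S ∈ E₃ ↔ S ∈ G₃ (Kset U (S ∪ F) v)))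
    (hloc₁ : ∀ K (T R : Finset (Sym2 V)), (∀ e ∈ T, v ∈ e) → (T ∪ R ∈ G₁ K ↔ R ∈ G₁ K))
    (hloc₃ : ∀ K (T R : Finset (Sym2 V)), (∀ e ∈ T, v ∈ e) → (T ∪ R ∈ G₃ K ↔ R ∈ G₃ K))
    (hle : ∀ K : Set V, K ⊆ Kset U E v → PrW D p (G₁ K) * c₂ ≤ PrW D p (G₃ K) * c₄) :
    PrW D p E₁ * c₂ ≤ PrW D p E₃ * c₄ := by
  -- split `D` into the star `A` of `v` and the rest `B`
  set A : Finset (Sym2 V) := D.filter (fun e => v ∈ e) with hA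
  set B : Finset (Sym2 V) := D.filter (fun e => v ∉ e) with hB
  have hAB : Disjoint A B := Finset.disjoint_filter_filter_not D D (fun e => v ∈ e)
  have hDAB : D = A ∪ B := (Finset.filter_union_filter_not_eq (fun e => v ∈ e) D).symm
  have hAv : ∀ T, T ⊆ A → ∀ e ∈ T, v ∈ e := fun T hT e he => (Finset.mem_filter.1 (hT he)).2
  have hBv : ∀ R, R ⊆ B → ∀ e ∈ R, v ∉ e := fun R hR e he => (Finset.mem_filter.1 (hR he)).2
  have hAD' : ∀ T, T ⊆ A → T ⊆ D := fun T hT => hT.trans (Finset.filter_subset _ _)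
  -- locality of the translated events: their `D`-mass is their `B`-mass
  have hlocal : ∀ (G : Set V → Set (Finset (Sym2 V))),
      (∀ K (T R : Finset (Sym2 V)), (∀ e ∈ T, v ∈ e) → (T ∪ R ∈ G K ↔ R ∈ G K)) →
      ∀ K, PrW D p (G K) = PrW B p (G K) := by
    intro G hG K
    rw [hDAB]
    exact PrW_local hAB p fun T hT R _ => hG K T R (hAv T hT)
  -- the two `K`-dependent factors as sums over the star configuration
  have hfac : ∀ (Ev : Set (Finset (Sym2 V))) (G : Set V → Set (Finset (Sym2 V))),
      (∀ S, S ⊆ D → (S ∈ Ev ↔ S ∈ G (Kset U (S ∪ F) v))) →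
      (∀ K (T R : Finset (Sym2 V)), (∀ e ∈ T, v ∈ e) → (T ∪ R ∈ G K ↔ R ∈ G K)) →
      PrW D p Ev = ∑ T ∈ A.powerset, wtW A p T * PrW B p (G (Kset U (T ∪ F) v)) := by
    intro Ev G htr hG
    rw [hDAB, PrW_union_eq_sum hAB]
    refine Finset.sum_congr rfl fun T hT => ?_
    have hT' := Finset.mem_powerset.1 hT
    rw [PrW_eq_sum_ind]
    congr 1
    refine Finset.sum_congr rfl fun R hR => ?_
    have hR' := Finset.mem_powerset.1 hR
    have hTRD : T ∪ R ⊆ D := by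
      rw [hDAB]; exact Finset.union_subset_union hT' hR'
    have hK : Kset U (T ∪ R ∪ F) v = Kset U (T ∪ F) v := Kset_union_of_avoid (hBv R hR')
    have h := htr (T ∪ R) hTRD
    rw [hK, hG _ T R (hAv T hT')] at h
    by_cases hm : T ∪ R ∈ Ev
    · rw [ind_of_mem hm, ind_of_mem (h.1 hm)]
    · rw [ind_of_not_mem hm, ind_of_not_mem (fun h' => hm (h.2 h'))]
  rw [hfac E₁ G₁ htr₁ hloc₁, hfac E₃ G₃ htr₃ hloc₃, Finset.sum_mul, Finset.sum_mul]
  -- termwise comparison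
  refine Finset.sum_le_sum fun T hT => ?_
  have hT' := Finset.mem_powerset.1 hT
  have hKT : Kset U (T ∪ F) v ⊆ Kset U E v := Kset_mono (Finset.union_subset ((hAD' T hT').trans hDE) hFE)
  have h := hle _ hKT
  rw [hlocal G₁ hloc₁, hlocal G₃ hloc₃] at h
  rw [mul_assoc, mul_assoc]
  exact mul_le_mul_of_nonneg_left h (wtW_nonneg A hp0 hp1 T)

end Diag

/-! ### The deleted-terminal rows -/

section Deleted

variable {D F E : Finset (Sym2 V)} {p : Sym2 V → ℝ} {a : V}

/-- Removing a non-neighbour `b` of `v` from the universe does not change the open neighbourhood of `v`. [this work] -/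
theorem Kset_erase_of_not_mem {U : Finset V} {O : Finset (Sym2 V)} {v b : V} (h : s(v, b) ∉ O) :
    Kset (U.erase b) O v = Kset U O v := by
  ext d
  simp only [mem_Kset, Finset.mem_erase]
  constructor
  · rintro ⟨⟨-, hdU⟩, hne, hO⟩
    exact ⟨hdU, hne, hO⟩
  · rintro ⟨hdU, hne, hO⟩
    refine ⟨⟨?_, hdU⟩, hne, hO⟩
    rintro rfl
    exact h hO

/-- **TW1({b}) — deleted terminal `b`.**  For all `a, b, c ∈ U` with `a ≠ b`, `b ≠ c`:
`P(a~b~c) · P_{U∖b}(C_a meets every N(b)–c support path) ≤ P(a~b) · P_{U∖b}(a~c)`,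
where `N(b) = Kset U E b` is the support neighbourhood of `b` and `P_{U∖b}` means the event is computed in the universe
without `b` (edges at `b` invisible).  Corollary of `bt0` by conditioning on the open star of `b`. [this work] -/
theorem tw1_erase (hp0 : ∀ e, 0 ≤ p e) (hp1 : ∀ e, p e ≤ 1) (hDE : D ⊆ E) (hFE : F ⊆ E) (U : Finset V)
    {b c : V} (haU : a ∈ U) (hbU : b ∈ U) (hcU : c ∈ U) (hab : a ≠ b) (hbc : b ≠ c) :
    PrW D p (evT U F a {b} {c}) *
        PrW D p {S : Finset (Sym2 V) | S ∪ F ∈ sepEv (U.erase b) E a (Kset U E b) {c}} ≤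
      PrW D p (evXi U F a {b} ∅) * PrW D p (evXi (U.erase b) F a {c} ∅) := by
  have hbb : b ∈ ({b} : Set V) := rfl
  have hbc' : b ∉ ({c} : Set V) := fun h => hbc (Set.mem_singleton_iff.1 h)
  have hbe : b ∉ (∅ : Set V) := fun h => h
  refine diag_step hp0 hp1 hDE hFE U b _ _ _ _
    (fun K => evT (U.erase b) F a (({b} \ {b}) ∪ K) {c})
    (fun K => evXi (U.erase b) F a (({b} \ {b}) ∪ K) ∅)
    (fun S _ => mem_evT_peel_iff_left hbU hab hbb hbc')
    (fun S _ => mem_evXi_peel_hub_iff hbU hab hbb hbe)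
    (fun K T R hT => union_mem_evT_erase_iff hT R _ _)
    (fun K T R hT => union_mem_evXi_erase_iff hT R _ _)
    ?_
  intro K hK
  have hKe : (({b} : Set V) \ {b}) ∪ K = K := by
    rw [sdiff_self, Set.bot_eq_empty, Set.empty_union]
  rw [hKe]
  -- `BT₀` on `U ∖ b` with `M = K`, `X = {c}`, and antitonicity of `Sep` in the separated set
  have haU' : a ∈ U.erase b := Finset.mem_erase.2 ⟨hab, haU⟩
  have hKU' : K ⊆ ↑(U.erase b) := fun d hd => by
    rw [Finset.coe_erase]
    exact ⟨(hK hd).1, fun h => (hK hd).2.1 (Set.mem_singleton_iff.1 h)⟩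
  have hcU' : ({c} : Set V) ⊆ ↑(U.erase b) := by
    intro x hx
    rw [Set.mem_singleton_iff.1 hx, Finset.coe_erase]
    exact ⟨hcU, fun h => hbc (Set.mem_singleton_iff.1 h).symm⟩
  have h0 := bt0 hp0 hp1 hDE hFE (U.erase b) (M := K) (X := {c}) haU' hKU' hcU'
  have hsep : PrW D p {S : Finset (Sym2 V) | S ∪ F ∈ sepEv (U.erase b) E a (Kset U E b) {c}} ≤
      PrW D p {S : Finset (Sym2 V) | S ∪ F ∈ sepEv (U.erase b) E a K {c}} := by
    refine PrW_mono D hp0 hp1 fun S _ hS => ?_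
    rw [Set.mem_setOf_eq] at hS ⊢
    exact sepEv_anti hK (subset_refl _) hS
  exact (mul_le_mul_of_nonneg_left hsep (PrW_nonneg D hp0 hp1 _)).trans h0

/-- **TW2° — both terminals deleted.**  For all `a, b, c ∈ U` with `a ≠ b`, `a ≠ c`, `b ≠ c` and `bc` not a support edge:
`P(a~b~c) · P_{U∖{b,c}}(C_a separates N(b) from N(c) in the support) ≤ P_{U∖c}(a~b) · P_{U∖b}(a~c)`.
Corollary of `bt0` by conditioning on the open stars of `c` and of `b` (two applications of `diag_step`), ending in
`BT₀(K, K′)` on `U ∖ {b,c}` for the two open neighbourhoods.  The hypothesis `bc ∉ E` cannot be dropped: on the triangle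
with `p(ab) = p(ac) = ε`, `p(bc) = 1` the left side is `2ε − ε²` (the separating event is sure: `a ∈ N(b) ∩ N(c)`) and the
right side is `ε²`. [this work] -/
theorem tw2_erase (hp0 : ∀ e, 0 ≤ p e) (hp1 : ∀ e, p e ≤ 1) (hDE : D ⊆ E) (hFE : F ⊆ E) (U : Finset V)
    {b c : V} (haU : a ∈ U) (hbU : b ∈ U) (hcU : c ∈ U) (hab : a ≠ b) (hac : a ≠ c) (hbc : b ≠ c)
    (hbcE : s(b, c) ∉ E) :
    PrW D p (evT U F a {b} {c}) *
        PrW D p {S : Finset (Sym2 V) | S ∪ F ∈ sepEv ((U.erase b).erase c) E a (Kset U E b) (Kset U E c)} ≤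
      PrW D p (evXi (U.erase c) F a {b} ∅) * PrW D p (evXi (U.erase b) F a {c} ∅) := by
  have hcbE : s(c, b) ∉ E := by rw [Sym2.eq_swap]; exact hbcE
  -- Step A: peel `c` (a hub vertex in factor 1 and in the factor `P_{U∖b}(a~c)`)
  have hcc : c ∈ ({c} : Set V) := rfl
  have hcb : c ∉ ({b} : Set V) := fun h => hbc (Set.mem_singleton_iff.1 h).symm
  have hce : c ∉ (∅ : Set V) := fun h => h
  have hcU1 : c ∈ U.erase b := Finset.mem_erase.2 ⟨hbc.symm, hcU⟩
  have hKc : ∀ S, S ⊆ D → Kset (U.erase b) (S ∪ F) c = Kset U (S ∪ F) c := fun S hS =>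
    Kset_erase_of_not_mem fun h => hcbE (Finset.union_subset (hS.trans hDE) hFE h)
  rw [mul_comm (PrW D p (evXi (U.erase c) F a {b} ∅))]
  refine diag_step hp0 hp1 hDE hFE U c _ _ _ _
    (fun K' => evT (U.erase c) F a {b} (({c} \ {c}) ∪ K'))
    (fun K' => evXi ((U.erase b).erase c) F a (({c} \ {c}) ∪ K') ∅)
    (fun S _ => mem_evT_peel_iff hcU hac hcc hcb)
    (fun S hS => by
      have h := mem_evXi_peel_hub_iff (F := F) (S := S) hcU1 hac hcc hce
      rw [hKc S hS] at h
      exact h)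
    (fun K T R hT => union_mem_evT_erase_iff hT R _ _)
    (fun K T R hT => union_mem_evXi_erase_iff hT R _ _)
    ?_
  intro K' hK'
  have hKe' : (({c} : Set V) \ {c}) ∪ K' = K' := by
    rw [sdiff_self, Set.bot_eq_empty, Set.empty_union]
  rw [hKe', mul_comm (PrW D p (evXi ((U.erase b).erase c) F a K' ∅))]
  -- Step B: peel `b` (universe `U ∖ c`)
  have hbU1 : b ∈ U.erase c := Finset.mem_erase.2 ⟨hbc, hbU⟩
  have hbb : b ∈ ({b} : Set V) := rfl
  have hbK' : b ∉ K' := fun h => hcbE (hK' h).2.2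
  have hbe : b ∉ (∅ : Set V) := fun h => h
  refine diag_step hp0 hp1 hDE hFE (U.erase c) b _ _ _ _
    (fun K => evT ((U.erase c).erase b) F a (({b} \ {b}) ∪ K) K')
    (fun K => evXi ((U.erase c).erase b) F a (({b} \ {b}) ∪ K) ∅)
    (fun S _ => mem_evT_peel_iff_left hbU1 hab hbb hbK')
    (fun S _ => mem_evXi_peel_hub_iff hbU1 hab hbb hbe)
    (fun K T R hT => union_mem_evT_erase_iff hT R _ _)
    (fun K T R hT => union_mem_evXi_erase_iff hT R _ _)
    ?_
  intro K hK
  have hKe : (({b} : Set V) \ {b}) ∪ K = K := by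
    rw [sdiff_self, Set.bot_eq_empty, Set.empty_union]
  have hUU : (U.erase c).erase b = (U.erase b).erase c := Finset.erase_right_comm
  rw [hKe, hUU]
  -- `BT₀(K, K′)` on `U ∖ {b,c}`, and antitonicity of `Sep` in both separated sets
  have haU2 : a ∈ (U.erase b).erase c := Finset.mem_erase.2 ⟨hac, Finset.mem_erase.2 ⟨hab, haU⟩⟩
  have hKU2 : K ⊆ ↑((U.erase b).erase c) := fun d hd => by
    have hd' := hK hd
    rw [mem_Kset, Finset.mem_erase] at hd'
    rw [Finset.coe_erase, Finset.coe_erase]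
    exact ⟨⟨hd'.1.2, fun h => hd'.2.1 (Set.mem_singleton_iff.1 h)⟩, fun h => hd'.1.1 (Set.mem_singleton_iff.1 h)⟩
  have hKU2' : K' ⊆ ↑((U.erase b).erase c) := fun d hd => by
    have hd' := hK' hd
    rw [Finset.coe_erase, Finset.coe_erase]
    refine ⟨⟨hd'.1, fun h => ?_⟩, fun h => hd'.2.1 (Set.mem_singleton_iff.1 h)⟩
    rw [Set.mem_singleton_iff] at h
    subst h
    exact hcbE hd'.2.2
  have hKb : K ⊆ Kset U E b := fun d hd => by
    have hd' := hK hd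
    rw [mem_Kset, Finset.mem_erase] at hd'
    exact ⟨hd'.1.2, hd'.2.1, hd'.2.2⟩
  have h0 := bt0 hp0 hp1 hDE hFE ((U.erase b).erase c) (M := K) (X := K') haU2 hKU2 hKU2'
  have hsep : PrW D p {S : Finset (Sym2 V) |
        S ∪ F ∈ sepEv ((U.erase b).erase c) E a (Kset U E b) (Kset U E c)} ≤
      PrW D p {S : Finset (Sym2 V) | S ∪ F ∈ sepEv ((U.erase b).erase c) E a K K'} := by
    refine PrW_mono D hp0 hp1 fun S _ hS => ?_
    rw [Set.mem_setOf_eq] at hS ⊢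
    exact sepEv_anti hKb hK' hS
  exact (mul_le_mul_of_nonneg_left hsep (PrW_nonneg D hp0 hp1 _)).trans h0

end Deleted

end DualBHK

end Summit.CriticalPhenomena.PercolationContinuityZ3.Theorems
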